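import Literature.Combinatorics.Additive.LinearKneserDuality
import HarnessLib

/-!
# Kneser's theorem for field extensions — structure of cells and kernels (Bachoc–Serra–Zémor §3)

Topic `Literature/Combinatorics/Additive`; third proof file behind the named fact
`Literature.Combinatorics.Additive.LinearKneser`, following C. Bachoc, O. Serra, G. Zémor,
*Revisiting Kneser's theorem for field extensions*, Combinatorica 38 (2018) = arXiv:1510.01354
(BSZ), §3, in the finite-dimensional reformulation explained in `LinearKneserBoundary.lean` and
`LinearKneserDuality.lean` (cells are finite-dimensional; dual cells enter only through `dmeet`).

Standing hypotheses of BSZ §3, bundled as `Hyp S`: `1 ∈ S`; `L = F(S)` in the form "a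
finite-dimensional `X` with `XS ⊆ X` is `0` or `L`"; `H(S) = F`, i.e. `F·1` is saturated; and
there is a finite-dimensional `T ≠ 0` with `TS ≠ L` and `dim ST ≤ dim S + dim T - 2`.
Levels (`levels S`, BSZ's `λ_1 < λ_2 < ⋯`) are indexed by their VALUE `λ ∈ ℕ` rather than by
`i`; the `λ`-kernel containing `1` is `ker S λ` (a choice; BSZ's `F_i`), and BSZ's induction on
`i` (the set `J`) is a strong induction on `λ`, the induction hypothesis being membership of the
smaller levels in `goodLevels S` (nested kernels, kernels are fields, kernels stabilise their
cells). Main results: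

* `not_mul_le_of_lt` — BSZ Lemma 17; `lemma18` — BSZ Lemma 18 (for every smaller kernel at once);
* `ker_le_ker_of_lt` — BSZ Prop. 20 (with Lemma 19 as the base of the same induction);
* `ker_mul_ker_le` — BSZ Prop. 21; `ker_mul_le_of_mem_cellsAt` — BSZ Prop. 22;
* `mem_goodLevels` — BSZ Theorem 15; `exists_stabilizer` — BSZ Theorem 3 in the case `L = F(S)`
  (§4, first paragraph): one field `K ≠ F` with `STK = ST` for every `T` of small product.

## References
* [BachocSerraZemor2018Kneser] C. Bachoc, O. Serra, G. Zémor, Combinatorica 38 (2018) 759–777,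
  §3 (Theorem 15, Proposition 16, Lemmas 17–19, Propositions 20–22), §4.
-/

noncomputable section

open Module Submodule
open scoped Pointwise

namespace Literature.Combinatorics.Additive.LinKneser

variable {F L : Type*} [Field F] [Field L] [Algebra F L]

attribute [local instance] finiteDimensional_mul finiteDimensional_smul finiteDimensional_dmeet

/-! ### Standing hypotheses, levels, kernels -/

/-- The standing hypotheses of BSZ §3 on `S` (with `L` the ambient field): `1 ∈ S`;
`F(S) = L` ("a finite-dimensional `X` with `XS ⊆ X` is `0` or `L`"); `H(S) = F` ("`F·1` is
saturated"); and some finite-dimensional `T ≠ 0` has `TS ≠ L` and `dim TS + 2 ≤ dim T + dim S`.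
[cite: BachocSerraZemor2018Kneser, Section 3 (first paragraph)] -/
structure Hyp (S : Submodule F L) : Prop where
  one_mem : (1 : L) ∈ S
  gen : ∀ X : Submodule F L, FiniteDimensional F X → X * S ≤ X → X = ⊥ ∨ X = ⊤
  satur_one : satur S (Submodule.span F {(1 : L)}) = Submodule.span F {(1 : L)}
  small : ∃ T : Submodule F L, FiniteDimensional F T ∧ T ≠ ⊥ ∧ T * S ≠ ⊤ ∧
    finrank F ↥(T * S) + 2 ≤ finrank F T + finrank F S

/-- The cells of level `n`. [cite: BachocSerraZemor2018Kneser, Section 3] -/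
def cellsAt (S : Submodule F L) (n : ℕ) : Set (Submodule F L) := {X | X ∈ cells S ∧ bdry S X = n}

/-- The `n`-kernels containing `1`: cells of level `n` containing `1` of least dimension among
cells of level `n`. [cite: BachocSerraZemor2018Kneser, Section 3] -/
def kernels (S : Submodule F L) (n : ℕ) : Set (Submodule F L) :=
  {N | N ∈ cellsAt S n ∧ (1 : L) ∈ N ∧ ∀ X ∈ cellsAt S n, finrank F N ≤ finrank F X}

open Classical in
/-- A chosen `n`-kernel containing `1` (BSZ's `F_i` for `n = λ_i`; `⊥` off the levels).
[cite: BachocSerraZemor2018Kneser, Section 3] -/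
def ker (S : Submodule F L) (n : ℕ) : Submodule F L :=
  if h : (kernels S n).Nonempty then h.some else ⊥

/-- The levels at which BSZ Theorem 15 holds: kernels below are larger, the kernel is
multiplicatively closed (a field), and it stabilises every cell of its level.
[cite: BachocSerraZemor2018Kneser, Theorem 15] -/
def goodLevels (S : Submodule F L) : Set ℕ :=
  {n | (∀ m ∈ levels S, m < n → ker S n ≤ ker S m) ∧ ker S n * ker S n ≤ ker S n ∧
    ∀ X ∈ cellsAt S n, ker S n * X ≤ X}

section Basics

variable {S : Submodule F L}

/-- Unfolding `cellsAt`. [cite: BachocSerraZemor2018Kneser, Section 3] -/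
theorem mem_cellsAt {n : ℕ} {X : Submodule F L} : X ∈ cellsAt S n ↔ X ∈ cells S ∧ bdry S X = n :=
  Iff.rfl

/-- A subspace containing a nonzero element is nonzero. [folklore] -/
theorem ne_bot_of_mem' {X : Submodule F L} {x : L} (hx : x ∈ X) (hx0 : x ≠ 0) : X ≠ ⊥ :=
  fun h => hx0 ((Submodule.mem_bot F).mp (h ▸ hx))

/-- Criterion for being a cell. [cite: BachocSerraZemor2018Kneser, Section 3] -/
theorem mem_cells_of {X : Submodule F L} (hfd : FiniteDimensional F X) (hsat : satur S X = X)
    {x : L} (hx : x ∈ X) (hx0 : x ≠ 0) (htop : X ≠ ⊤) : X ∈ cells S :=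
  ⟨hfd, hsat, ne_bot_of_mem' hx hx0, htop⟩

/-- If `K U ≤ U` and `x ∈ U` then `x • K ≤ U`. [folklore] -/
theorem smul_le_of_mul_le {K U : Submodule F L} (h : K * U ≤ U) {x : L} (hx : x ∈ U) :
    x • K ≤ U := by
  intro y hy
  obtain ⟨k, hk, rfl⟩ := mem_smul_iff.mp hy
  rw [mul_comm]
  exact h (Submodule.mul_mem_mul hk hx)

/-- If `x • K ≤ U` for all `x ∈ U` then `K U ≤ U`. [folklore] -/
theorem mul_le_of_smul_le {K U : Submodule F L} (h : ∀ x ∈ U, x • K ≤ U) : K * U ≤ U := by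
  rw [Submodule.mul_le]
  intro k hk x hx
  rw [mul_comm]
  exact h x hx (mul_mem_smul hk)

/-- Kernels containing `1` exist at every level. [cite: BachocSerraZemor2018Kneser, Section 3] -/
theorem kernels_nonempty {n : ℕ} (hn : n ∈ levels S) : (kernels S n).Nonempty := by
  classical
  -- a cell of level `n` of minimal dimension
  have hex : ∃ d, ∃ X ∈ cellsAt S n, finrank F X = d := by
    obtain ⟨X, hX, hXn⟩ := hn
    exact ⟨_, X, ⟨hX, hXn⟩, rfl⟩
  obtain ⟨X, hX, hXd⟩ := Nat.find_spec hex
  have hmin : ∀ Y ∈ cellsAt S n, finrank F X ≤ finrank F Y := by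
    intro Y hY
    rw [hXd]
    exact Nat.find_min' hex ⟨Y, hY, rfl⟩
  obtain ⟨x, hx, hx0⟩ := (Submodule.ne_bot_iff X).mp hX.1.2.2.1
  refine ⟨x⁻¹ • X, ⟨smul_mem_cells (inv_ne_zero hx0) hX.1, ?_⟩, ?_, fun Y hY => ?_⟩
  · rw [bdry_smul (inv_ne_zero hx0), hX.2]
  · exact mem_smul_iff.mpr ⟨x, hx, inv_mul_cancel₀ hx0⟩
  · rw [finrank_smul (inv_ne_zero hx0)]
    exact hmin Y hY

/-- The defining properties of `ker S n` at a level `n`.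
[cite: BachocSerraZemor2018Kneser, Section 3] -/
theorem ker_spec {n : ℕ} (hn : n ∈ levels S) :
    ker S n ∈ cellsAt S n ∧ (1 : L) ∈ ker S n ∧ ∀ X ∈ cellsAt S n, finrank F (ker S n) ≤ finrank F X := by
  have h := kernels_nonempty hn
  rw [ker, dif_pos h]
  exact h.some_mem

/-- `ker S n` is a cell of level `n`. [cite: BachocSerraZemor2018Kneser, Section 3] -/
theorem ker_mem_cellsAt {n : ℕ} (hn : n ∈ levels S) : ker S n ∈ cellsAt S n :=
  (ker_spec hn).1

/-- `1 ∈ ker S n`. [cite: BachocSerraZemor2018Kneser, Section 3] -/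
theorem one_mem_ker {n : ℕ} (hn : n ∈ levels S) : (1 : L) ∈ ker S n :=
  (ker_spec hn).2.1

/-- Kernel minimality: every cell of level `n` has dimension `≥ dim ker S n`.
[cite: BachocSerraZemor2018Kneser, Section 3] -/
theorem finrank_ker_le {n : ℕ} (hn : n ∈ levels S) {X : Submodule F L} (hX : X ∈ cellsAt S n) :
    finrank F (ker S n) ≤ finrank F X :=
  (ker_spec hn).2.2 X hX

/-- Kernels are finite-dimensional. [cite: BachocSerraZemor2018Kneser, Section 3] -/
theorem finiteDimensional_ker {n : ℕ} (hn : n ∈ levels S) : FiniteDimensional F (ker S n) :=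
  (ker_mem_cellsAt hn).1.1

/-- Kernels are saturated. [cite: BachocSerraZemor2018Kneser, Section 3] -/
theorem satur_ker {n : ℕ} (hn : n ∈ levels S) : satur S (ker S n) = ker S n :=
  (ker_mem_cellsAt hn).1.2.1

/-- Kernels are proper. [cite: BachocSerraZemor2018Kneser, Section 3] -/
theorem ker_ne_top {n : ℕ} (hn : n ∈ levels S) : ker S n ≠ ⊤ :=
  (ker_mem_cellsAt hn).1.2.2.2

/-- `∂ (ker S n) = n`. [cite: BachocSerraZemor2018Kneser, Section 3] -/
theorem bdry_ker {n : ℕ} (hn : n ∈ levels S) : bdry S (ker S n) = n :=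
  (ker_mem_cellsAt hn).2

/-- `dim (ker S n · S) = n + dim ker S n`. [cite: BachocSerraZemor2018Kneser, Section 3] -/
theorem finrank_ker_mul (h1 : (1 : L) ∈ S) [FiniteDimensional F S] {n : ℕ} (hn : n ∈ levels S) :
    haveI := finiteDimensional_ker hn
    finrank F ↥(ker S n * S) = n + finrank F (ker S n) := by
  haveI := finiteDimensional_ker hn
  have := bdry_add_finrank h1 (ker S n)
  rw [bdry_ker hn] at this
  omega

/-- A cell of level `n` inside a kernel translate `x • ker S n` of its level is all of it.
[cite: BachocSerraZemor2018Kneser, Section 3] -/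
theorem eq_smul_ker_of_le {n : ℕ} (hn : n ∈ levels S) {X : Submodule F L} (hX : X ∈ cellsAt S n)
    {x : L} (hx0 : x ≠ 0) (hle : X ≤ x • ker S n) : X = x • ker S n := by
  haveI := finiteDimensional_ker hn
  refine Submodule.eq_of_le_of_finrank_le hle ?_
  rw [finrank_smul hx0]
  exact finrank_ker_le hn hX

/-- A translate `x • ker S n` (`x ≠ 0`) is a cell of level `n` containing `x`.
[cite: BachocSerraZemor2018Kneser, Section 3] -/
theorem smul_ker_mem_cellsAt {n : ℕ} (hn : n ∈ levels S) {x : L} (hx0 : x ≠ 0) :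
    x • ker S n ∈ cellsAt S n :=
  ⟨smul_mem_cells hx0 (ker_mem_cellsAt hn).1, by rw [bdry_smul hx0, bdry_ker hn]⟩

/-- The intermediate field underlying a multiplicatively closed kernel.
[cite: BachocSerraZemor2018Kneser, Proposition 21] -/
def kerField {n : ℕ} (hn : n ∈ levels S) (hmul : ker S n * ker S n ≤ ker S n) :
    IntermediateField F L :=
  haveI := finiteDimensional_ker hn
  toIntermediateField (ker S n) (one_mem_ker hn) hmul

/-- Membership in `kerField`. [cite: BachocSerraZemor2018Kneser, Proposition 21] -/
@[simp] theorem mem_kerField {n : ℕ} (hn : n ∈ levels S) (hmul : ker S n * ker S n ≤ ker S n)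
    {x : L} : x ∈ kerField hn hmul ↔ x ∈ ker S n :=
  Iff.rfl

/-- `kerField` has the dimension of the kernel. [cite: BachocSerraZemor2018Kneser, Proposition 21] -/
theorem finrank_kerField {n : ℕ} (hn : n ∈ levels S) (hmul : ker S n * ker S n ≤ ker S n) :
    finrank F (kerField hn hmul) = finrank F (ker S n) := by
  haveI := finiteDimensional_ker hn
  exact finrank_toIntermediateField _ _ _

/-- `kerField` is finite-dimensional. [cite: BachocSerraZemor2018Kneser, Proposition 21] -/
theorem finiteDimensional_kerField {n : ℕ} (hn : n ∈ levels S)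
    (hmul : ker S n * ker S n ≤ ker S n) : FiniteDimensional F (kerField hn hmul) := by
  haveI := finiteDimensional_ker hn
  have hpos : 0 < finrank F (ker S n) :=
    Nat.pos_of_ne_zero fun h =>
      ne_bot_of_mem' (one_mem_ker hn) one_ne_zero (Submodule.finrank_eq_zero.mp h)
  apply FiniteDimensional.of_finrank_pos
  rw [finrank_kerField hn hmul]
  exact hpos

/-- A multiplicatively closed kernel is a field: `x • ker S n = ker S n` for `x ∈ ker S n ∖ 0`.
[cite: BachocSerraZemor2018Kneser, Proposition 21] -/
theorem smul_ker_eq_of_mem {n : ℕ} (hn : n ∈ levels S) (hmul : ker S n * ker S n ≤ ker S n)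
    {x : L} (hx : x ∈ ker S n) (hx0 : x ≠ 0) : x • ker S n = ker S n := by
  haveI := finiteDimensional_ker hn
  refine Submodule.eq_of_le_of_finrank_le ?_ (by rw [finrank_smul hx0])
  rw [← span_singleton_mul]
  exact (mul_le_mul_left ((Submodule.span_singleton_le_iff_mem x _).mpr hx) _).trans hmul

/-- If `1 ∈ x • ker S n` for a multiplicatively closed kernel then `x • ker S n = ker S n`.
[cite: BachocSerraZemor2018Kneser, Lemma 19 (last sentence)] -/
theorem smul_ker_eq_of_one_mem {n : ℕ} (hn : n ∈ levels S) (hmul : ker S n * ker S n ≤ ker S n)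
    {x : L} (hx0 : x ≠ 0) (h1 : (1 : L) ∈ x • ker S n) : x • ker S n = ker S n := by
  obtain ⟨y, hy, hxy⟩ := mem_smul_iff.mp h1
  have hyinv : y = x⁻¹ := by
    rw [← mul_inv_cancel₀ hx0] at hxy
    exact mul_left_cancel₀ hx0 hxy
  have hxmem : x ∈ ker S n := by
    have : x⁻¹ ∈ kerField hn hmul := hyinv ▸ hy
    have := (kerField hn hmul).inv_mem this
    rwa [inv_inv] at this
  exact smul_ker_eq_of_mem hn hmul hxmem hx0


variable (H : Hyp S) [FiniteDimensional F S]
include H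

/-- Under `Hyp S`, cells have positive boundary (`Λ ∋ 0` only for `0` and `L`).
[cite: BachocSerraZemor2018Kneser, Section 3 (`𝒮_0 = {0, L}`)] -/
theorem Hyp.bdry_pos {X : Submodule F L} (hX : X ∈ cells S) : 0 < bdry S X := by
  obtain ⟨hfd, -, hb, ht⟩ := hX
  by_contra h0
  have h0 : bdry S X = 0 := by omega
  have hle : X * S ≤ X := by
    have e := bdry_add_finrank H.one_mem X
    rw [h0, zero_add] at e
    exact (Submodule.eq_of_le_of_finrank_le (le_mul_of_one_mem H.one_mem X) e.ge).symm.le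
  rcases H.gen X hfd hle with h | h
  · exact hb h
  · exact ht h

/-- Levels are positive. [cite: BachocSerraZemor2018Kneser, Section 3] -/
theorem Hyp.level_pos {m : ℕ} (hm : m ∈ levels S) : 0 < m := by
  obtain ⟨X, hX, rfl⟩ := hm
  exact H.bdry_pos hX

/-- `dim S ≥ 2`. [cite: BachocSerraZemor2018Kneser, Section 3] -/
theorem Hyp.two_le_finrank : 2 ≤ finrank F S := by
  obtain ⟨T, hT, -, -, hsmall⟩ := H.small
  haveI := hT
  have := finrank_le_finrank_mul H.one_mem T
  omega

/-- `F · 1` is a cell of level `dim S - 1`. [cite: BachocSerraZemor2018Kneser, Section 3] -/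
theorem Hyp.span_one_mem_cellsAt : Submodule.span F {(1 : L)} ∈ cellsAt S (finrank F S - 1) := by
  have hS : Submodule.span F {(1 : L)} * S = S := by
    rw [← Submodule.one_eq_span, one_mul]
  refine ⟨mem_cells_of inferInstance H.satur_one (Submodule.mem_span_singleton_self _) one_ne_zero
    ?_, ?_⟩
  · intro htop
    have : S ≤ Submodule.span F {(1 : L)} := htop ▸ le_top
    have h1 : finrank F S ≤ 1 := (Submodule.finrank_mono this).trans (finrank_span_le_card _)
      |>.trans (by simp)
    have := H.two_le_finrank
    omega
  · have e := bdry_add_finrank H.one_mem (Submodule.span F {(1 : L)})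
    rw [finrank_span_singleton one_ne_zero] at e
    have : finrank F ↥(Submodule.span F {(1 : L)} * S) = finrank F S := by rw [hS]
    omega

/-- `dim S - 1` is a level. [cite: BachocSerraZemor2018Kneser, Section 3] -/
theorem Hyp.sub_one_mem_levels : finrank F S - 1 ∈ levels S :=
  ⟨_, H.span_one_mem_cellsAt.1, H.span_one_mem_cellsAt.2⟩

/-- There is a level `≤ dim S - 2` (from the subspace `T` of `Hyp`, saturated).
[cite: BachocSerraZemor2018Kneser, Section 3] -/
theorem Hyp.exists_level_add_two_le : ∃ m ∈ levels S, m + 2 ≤ finrank F S := by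
  obtain ⟨T, hT, hTb, hTt, hsmall⟩ := H.small
  haveI := hT
  haveI := finiteDimensional_satur H.one_mem T
  obtain ⟨t, ht, ht0⟩ := (Submodule.ne_bot_iff T).mp hTb
  have hcell : satur S T ∈ cells S := by
    refine mem_cells_of inferInstance (satur_satur S T) (le_satur S T ht) ht0 fun htop => ?_
    exact hTt (mul_eq_top_of_satur_eq_top H.one_mem htop)
  refine ⟨bdry S (satur S T), bdry_mem_levels hcell, ?_⟩
  have h1 := bdry_satur_le H.one_mem T
  have h2 := bdry_add_finrank H.one_mem T
  omega

end Basics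

section Structure

variable {S : Submodule F L}

/-- `S ≤ K S` when `1 ∈ K`. [folklore] -/
theorem le_mul_of_one_mem_left {K : Submodule F L} (h1 : (1 : L) ∈ K) (S : Submodule F L) :
    S ≤ K * S := fun s hs => by simpa using Submodule.mul_mem_mul h1 hs

/-- `K X ≤ X` implies `K (X S) ≤ X S`. [folklore] -/
theorem mul_mul_le {K X : Submodule F L} (h : K * X ≤ X) (S : Submodule F L) :
    K * (X * S) ≤ X * S := by
  rw [← mul_assoc]
  exact mul_le_mul_left h S

/-- The largest level below `n` (given one). [folklore] -/
theorem exists_max_level_lt {n m : ℕ} (hm : m ∈ levels S) (hmn : m < n) :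
    ∃ mx ∈ levels S, mx < n ∧ ∀ m' ∈ levels S, m' < n → m' ≤ mx := by
  classical
  refine ⟨Nat.findGreatest (· ∈ levels S) (n - 1), ?_, ?_, ?_⟩
  · exact Nat.findGreatest_spec (P := (· ∈ levels S)) (show m ≤ n - 1 by omega) hm
  · have := Nat.findGreatest_le (P := (· ∈ levels S)) (n - 1)
    omega
  · intro m' hm' hm'n
    exact Nat.le_findGreatest (show m' ≤ n - 1 by omega) hm'

variable (H : Hyp S) [FiniteDimensional F S]
include H

/-- **BSZ Lemma 17**: a cell of level `n' ≤ dim S - 1` is not stabilised by a (multiplicatively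
closed) kernel of a smaller level `m`: otherwise `dim ker_m` divides `n'` and `m`, so
`n' ≥ m + dim ker_m = dim (ker_m S) ≥ dim S`. [cite: BachocSerraZemor2018Kneser, Lemma 17] -/
theorem Hyp.not_mul_le_of_lt {m n' : ℕ} (hm : m ∈ levels S) (hmul : ker S m * ker S m ≤ ker S m)
    (hmn : m < n') (hn's : n' + 1 ≤ finrank F S) {X : Submodule F L} (hX : X ∈ cellsAt S n') :
    ¬ ker S m * X ≤ X := by
  intro hKX
  haveI := finiteDimensional_ker hm
  haveI : FiniteDimensional F X := hX.1.1
  have hK : ∀ {V : Submodule F L}, ker S m * V ≤ V → finrank F (ker S m) ∣ finrank F V := by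
    intro V hV
    rw [← finrank_kerField hm hmul]
    exact finrank_dvd_of_stable (kerField hm hmul) V
      fun k hk v hv => (Submodule.mul_le.mp hV) k hk v hv
  have d1 : finrank F (ker S m) ∣ finrank F X := hK hKX
  have d2 : finrank F (ker S m) ∣ finrank F ↥(X * S) := hK (mul_mul_le hKX S)
  have d3 : finrank F (ker S m) ∣ finrank F ↥(ker S m * S) := hK (mul_mul_le hmul S)
  have e1 := bdry_add_finrank H.one_mem X
  rw [hX.2] at e1
  have e2 := finrank_ker_mul H.one_mem hm
  have e3 : finrank F S ≤ finrank F ↥(ker S m * S) :=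
    Submodule.finrank_mono (le_mul_of_one_mem_left (one_mem_ker hm) S)
  have dn : finrank F (ker S m) ∣ n' := by
    have := Nat.dvd_sub d2 d1
    rwa [show finrank F ↥(X * S) - finrank F X = n' by omega] at this
  have dm : finrank F (ker S m) ∣ m := by
    have := Nat.dvd_sub d3 (dvd_refl _)
    rwa [show finrank F ↥(ker S m * S) - finrank F (ker S m) = m by omega] at this
  obtain ⟨a, ha⟩ := dn
  obtain ⟨b, hb⟩ := dm
  have hab : b < a := by
    by_contra h
    push Not at h
    have : n' ≤ m :=
      calc n' = finrank F (ker S m) * a := ha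
        _ ≤ finrank F (ker S m) * b := Nat.mul_le_mul_left _ h
        _ = m := hb.symm
    omega
  have key : m + finrank F (ker S m) ≤ n' := by
    have h1 : finrank F (ker S m) * (b + 1) ≤ finrank F (ker S m) * a :=
      Nat.mul_le_mul_left _ hab
    rw [mul_add, mul_one, ← hb, ← ha] at h1
    exact h1
  omega

/-- **BSZ Lemma 18** (for all smaller kernels at once): for levels `m < n ≤ dim S - 1` with the
levels `≤ m` good and `dim ker_n ≤ dim ker_m`, and `x ∈ ker_n ∖ 0`, the saturation of
`x ker_m + ker_n` is neither a kernel `ker_{m'}`, `m' < m`, nor `L`: its product with `S` has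
dimension `< dim(ker_m S) + dim ker_n`. [cite: BachocSerraZemor2018Kneser, Lemma 18] -/
theorem Hyp.lemma18 {m n : ℕ} (hm : m ∈ levels S) (hn : n ∈ levels S)
    (hns : n + 1 ≤ finrank F S) (hgood : ∀ m' ∈ levels S, m' ≤ m → m' ∈ goodLevels S)
    (hf : finrank F (ker S n) ≤ finrank F (ker S m)) {x : L} (hx : x ∈ ker S n) (hx0 : x ≠ 0) :
    (∀ m' ∈ levels S, m' < m → satur S (x • ker S m ⊔ ker S n) ≠ ker S m') ∧
      satur S (x • ker S m ⊔ ker S n) ≠ ⊤ := by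
  haveI := finiteDimensional_ker hm
  haveI := finiteDimensional_ker hn
  have hmg := hgood m hm le_rfl
  haveI := finiteDimensional_kerField hm hmg.2.1
  -- the dimension estimate
  have key : finrank F ↥((x • ker S m ⊔ ker S n) * S) + 1 ≤
      finrank F ↥(ker S m * S) + finrank F (ker S n) := by
    rw [Submodule.sup_mul, smul_mul]
    have md := Submodule.finrank_sup_add_finrank_inf_eq (x • (ker S m * S)) (ker S n * S)
    have hxS1 : x • S ≤ x • (ker S m * S) := smul_mono (le_mul_of_one_mem_left (one_mem_ker hm) S)
    have hxS2 : x • S ≤ ker S n * S := smul_le_mul hx S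
    have i1 : finrank F S ≤ finrank F ↥(x • (ker S m * S) ⊓ ker S n * S) := by
      rw [← finrank_smul hx0 S]
      exact Submodule.finrank_mono (le_inf hxS1 hxS2)
    have e1 : finrank F ↥(x • (ker S m * S)) = finrank F ↥(ker S m * S) := finrank_smul hx0 _
    have e2 := finrank_ker_mul H.one_mem hn
    omega
  have hYS : satur S (x • ker S m ⊔ ker S n) * S = (x • ker S m ⊔ ker S n) * S := satur_mul _ _
  have hstabm : ∀ k ∈ kerField hm hmg.2.1, ∀ u ∈ ker S m * S, k * u ∈ ker S m * S :=
    fun k hk u hu => mul_mul_le hmg.2.1 S (Submodule.mul_mem_mul hk hu)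
  constructor
  · intro m' hm' hm'm hY
    have hm'g := hgood m' hm' hm'm.le
    haveI := finiteDimensional_ker hm'
    have hle : ker S m ≤ ker S m' := hmg.1 m' hm' hm'm
    have hne : ker S m ≠ ker S m' := fun h => by
      have := bdry_ker hm
      rw [h, bdry_ker hm'] at this
      omega
    have hlt : ker S m * S < ker S m' * S := by
      refine lt_of_le_of_ne (mul_le_mul_left hle S) fun h => hne (le_antisymm hle ?_)
      rw [← satur_ker hm]
      intro z hz
      rw [mem_satur_iff_smul_le, h]
      exact smul_le_mul hz S
    have hstab' : ∀ k ∈ kerField hm hmg.2.1, ∀ u ∈ ker S m' * S, k * u ∈ ker S m' * S := by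
      intro k hk u hu
      have : ker S m * ker S m' ≤ ker S m' := (mul_le_mul_left hle _).trans hm'g.2.1
      exact mul_mul_le this S (Submodule.mul_mem_mul hk hu)
    have hstab := finrank_add_finrank_le_of_stable_lt (kerField hm hmg.2.1) hstabm hstab' hlt
    rw [finrank_kerField] at hstab
    have : finrank F ↥(satur S (x • ker S m ⊔ ker S n) * S) = finrank F ↥(ker S m' * S) := by
      rw [hY]
    rw [hYS] at this
    omega
  · intro hY
    have htop : (x • ker S m ⊔ ker S n) * S = ⊤ := mul_eq_top_of_satur_eq_top H.one_mem hY
    haveI : FiniteDimensional F L := by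
      have : FiniteDimensional F ↥((x • ker S m ⊔ ker S n) * S) := inferInstance
      rw [htop] at this
      exact Module.Finite.equiv (Submodule.topEquiv : (⊤ : Submodule F L) ≃ₗ[F] L)
    have hlt : ker S m * S < ⊤ := by
      refine lt_top_iff_ne_top.mpr fun h => ker_ne_top hm ?_
      rw [← satur_ker hm]
      refine eq_top_iff.mpr fun z _ => ?_
      rw [mem_satur_iff_smul_le, h]
      exact le_top
    have hstab := finrank_add_finrank_le_of_stable_lt (kerField hm hmg.2.1) hstabm
      (fun _ _ _ _ => Submodule.mem_top) hlt
    rw [finrank_kerField, finrank_top] at hstab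
    have : finrank F ↥((x • ker S m ⊔ ker S n) * S) = finrank F L := by rw [htop, finrank_top]
    omega

/-- **BSZ Proposition 20** (with Lemma 19): at a level `n ≤ dim S - 1` all of whose lower levels
are good, `ker_n ≤ ker_m` for every lower level `m`. [cite: BachocSerraZemor2018Kneser, Proposition 20] -/
theorem Hyp.ker_le_ker_of_lt {n : ℕ} (hn : n ∈ levels S) (hns : n + 1 ≤ finrank F S)
    (IH : ∀ m ∈ levels S, m < n → m ∈ goodLevels S) :
    ∀ m ∈ levels S, m < n → ker S n ≤ ker S m := by
  intro m
  induction m using Nat.strong_induction_on with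
  | _ m IH20 => ?_
  intro hm hmn
  haveI := finiteDimensional_ker hn
  haveI := finiteDimensional_ker hm
  have hmg := IH m hm hmn
  -- the largest lower level `mx`, whose kernel is the smallest lower kernel
  obtain ⟨mx, hmx, hmxn, hmxmax⟩ := exists_max_level_lt hm hmn
  have hmxg := IH mx hmx hmxn
  have hKmx : ∀ m' ∈ levels S, m' < n → ker S mx ≤ ker S m' := by
    intro m' hm' hm'n
    rcases (hmxmax m' hm' hm'n).lt_or_eq with h | h
    · exact hmxg.1 m' hm' h
    · rw [h]
  have hnot : ¬ ker S mx * ker S n ≤ ker S n :=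
    H.not_mul_le_of_lt hmx hmxg.2.1 hmxn hns (ker_mem_cellsAt hn)
  have hm1 : m + 1 ≤ finrank F S := by omega
  -- Step A: `dim ker_n ≤ dim ker_m`
  have hf : finrank F (ker S n) ≤ finrank F (ker S m) := by
    by_contra hf
    push Not at hf
    obtain ⟨σ, hσ⟩ := exists_functional_ne_zero (F := F) (L := L)
    apply hnot
    rw [Submodule.mul_le]
    intro k hk x hxN
    refine stable_of_stable_perp hσ (satur_ker hn) (fun y hy => ?_) x hxN
    by_cases hy0 : y = 0
    · rw [hy0, mul_zero]
      exact Submodule.zero_mem _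
    set V := dmeet σ S (y • ker S m) (ker S n) with hVdef
    set Z := dmeet σ S (ker S n) (y • ker S m) with hZdef
    have hyV : y ∈ V := ⟨self_mem_smul (one_mem_ker hm), hy⟩
    have hV_ne : V ≠ ⊥ := ne_bot_of_mem' hyV hy0
    have hZ_ne : Z ≠ ⊥ := by
      refine dmeet_ne_bot σ ?_ hV_ne ?_
      · rw [smul_mul, finrank_smul hy0, finrank_smul hy0, finrank_ker_mul H.one_mem hm]
        omega
      · rw [finrank_smul hy0]
        exact hf.le
    have hZsat : satur S Z = Z := satur_dmeet σ (satur_ker hn) (y • ker S m)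
    have hZle : Z ≤ ker S n := dmeet_le σ S _ _
    obtain ⟨z, hz, hz0⟩ := (Submodule.ne_bot_iff _).mp hZ_ne
    have hZcell : Z ∈ cells S :=
      mem_cells_of inferInstance hZsat hz hz0 fun h => ker_ne_top hn (eq_top_iff.mpr (h ▸ hZle))
    have hZlev : m ≤ bdry S Z := by
      by_contra hlt
      push Not at hlt
      have hm'' : bdry S Z ∈ levels S := bdry_mem_levels hZcell
      have hNle : ker S n ≤ ker S (bdry S Z) := IH20 (bdry S Z) hlt hm'' (by omega)
      haveI := finiteDimensional_ker hm''
      have h1 : finrank F (ker S (bdry S Z)) ≤ finrank F Z := finrank_ker_le hm'' ⟨hZcell, rfl⟩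
      have h2 : finrank F (ker S n) ≤ finrank F (ker S (bdry S Z)) := Submodule.finrank_mono hNle
      have hZN : Z = ker S n := Submodule.eq_of_le_of_finrank_le hZle (h2.trans h1)
      have : bdry S Z = n := by rw [hZN, bdry_ker hn]
      omega
    have hMS := bdry_dmeet_add_bdry_dmeet_le σ H.one_mem (y • ker S m) (ker S n)
    rw [bdry_smul hy0, bdry_ker hm, bdry_ker hn, ← hVdef, ← hZdef] at hMS
    have hVle : bdry S V ≤ n := by omega
    have hVsat : satur S V = V := satur_dmeet σ (satur_smul_of_eq hy0 (satur_ker hm)) (ker S n)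
    have hVyK : V ≤ y • ker S m := dmeet_le σ S _ _
    have hVcell : V ∈ cells S :=
      mem_cells_of inferInstance hVsat hyV hy0 fun h =>
        (smul_mem_cells hy0 (ker_mem_cellsAt hm).1).2.2.2 (eq_top_iff.mpr (h ▸ hVyK))
    have hVn : bdry S V ≠ n := by
      intro hVn
      have h1 := finrank_ker_le hn ⟨hVcell, hVn⟩
      have h2 : finrank F V ≤ finrank F ↥(y • ker S m) := Submodule.finrank_mono hVyK
      rw [finrank_smul hy0] at h2
      omega
    have hVlev : bdry S V ∈ levels S := bdry_mem_levels hVcell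
    have hVlt : bdry S V < n := lt_of_le_of_ne hVle hVn
    have hstabV : ker S (bdry S V) * V ≤ V := (IH (bdry S V) hVlev hVlt).2.2 V ⟨hVcell, rfl⟩
    have hKmxV : ker S mx * V ≤ V := (mul_le_mul_left (hKmx _ hVlev hVlt) V).trans hstabV
    exact ((Submodule.mul_le.mp hKmxV) k hk y hyV).2
  -- Step B: some `x ∈ ker_n ∖ 0` with `∂(x ker_m ∩ ker_n) ≥ n`
  have hB : ∃ x ∈ ker S n, x ≠ 0 ∧ n ≤ bdry S (x • ker S m ⊓ ker S n) := by
    by_contra hB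
    push Not at hB
    apply hnot
    rw [Submodule.mul_le]
    intro k hk x hxN
    by_cases hx0 : x = 0
    · rw [hx0, mul_zero]
      exact Submodule.zero_mem _
    have hZsat : satur S (x • ker S m ⊓ ker S n) = x • ker S m ⊓ ker S n :=
      satur_inf_of_eq (satur_smul_of_eq hx0 (satur_ker hm)) (satur_ker hn)
    have hxZ : x ∈ x • ker S m ⊓ ker S n := ⟨self_mem_smul (one_mem_ker hm), hxN⟩
    have hZcell : (x • ker S m ⊓ ker S n) ∈ cells S :=
      mem_cells_of inferInstance hZsat hxZ hx0 fun h =>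
        ker_ne_top hn (eq_top_iff.mpr (h ▸ inf_le_right))
    have hlev := bdry_mem_levels hZcell
    have hlt := hB x hxN hx0
    have hstab := (IH _ hlev hlt).2.2 _ ⟨hZcell, rfl⟩
    have hKmxZ : ker S mx * (x • ker S m ⊓ ker S n) ≤ x • ker S m ⊓ ker S n :=
      (mul_le_mul_left (hKmx _ hlev hlt) _).trans hstab
    exact ((Submodule.mul_le.mp hKmxZ) k hk x hxZ).2
  obtain ⟨x, hxN, hx0, hxB⟩ := hB
  -- Step C
  have h18 := H.lemma18 hm hn hns (fun m' hm' hle => IH m' hm' (lt_of_le_of_lt hle hmn)) hf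
    hxN hx0
  have hsub := bdry_satur_sup_add_bdry_inf_le H.one_mem (x • ker S m) (ker S n)
  rw [bdry_smul hx0, bdry_ker hm, bdry_ker hn] at hsub
  set Y := satur S (x • ker S m ⊔ ker S n) with hYdef
  haveI : FiniteDimensional F Y := finiteDimensional_satur H.one_mem _
  have h1Y : (1 : L) ∈ Y := le_satur S _ (Submodule.mem_sup_right (one_mem_ker hn))
  have hYcell : Y ∈ cells S := mem_cells_of inferInstance (satur_satur S _) h1Y one_ne_zero h18.2
  have hYlev : m ≤ bdry S Y := by
    by_contra hlt
    push Not at hlt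
    have hm' := bdry_mem_levels hYcell
    have hm'good := IH _ hm' (by omega)
    have hNle : ker S n ≤ ker S (bdry S Y) := IH20 _ hlt hm' (by omega)
    have hKle : ker S m ≤ ker S (bdry S Y) := hmg.1 _ hm' hlt
    haveI := finiteDimensional_ker hm'
    have hxK' : x • ker S (bdry S Y) = ker S (bdry S Y) :=
      smul_ker_eq_of_mem hm' hm'good.2.1 (hNle hxN) hx0
    have hYle : Y ≤ ker S (bdry S Y) := by
      rw [hYdef, ← satur_ker hm']
      refine satur_mono S (sup_le ?_ hNle)
      rw [← hxK']
      exact smul_mono hKle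
    have hYeq : Y = ker S (bdry S Y) :=
      Submodule.eq_of_le_of_finrank_le hYle (finrank_ker_le hm' ⟨hYcell, rfl⟩)
    exact h18.1 _ hm' hlt hYeq
  have hZn : bdry S (x • ker S m ⊓ ker S n) = n := by omega
  have hZsat : satur S (x • ker S m ⊓ ker S n) = x • ker S m ⊓ ker S n :=
    satur_inf_of_eq (satur_smul_of_eq hx0 (satur_ker hm)) (satur_ker hn)
  have hxZ : x ∈ x • ker S m ⊓ ker S n := ⟨self_mem_smul (one_mem_ker hm), hxN⟩
  have hZcell : (x • ker S m ⊓ ker S n) ∈ cells S :=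
    mem_cells_of inferInstance hZsat hxZ hx0 fun h => ker_ne_top hn (eq_top_iff.mpr (h ▸ inf_le_right))
  have hZN : x • ker S m ⊓ ker S n = ker S n :=
    Submodule.eq_of_le_of_finrank_le inf_le_right (finrank_ker_le hn ⟨hZcell, hZn⟩)
  have hNxK : ker S n ≤ x • ker S m := hZN ▸ inf_le_left
  have h1xK : (1 : L) ∈ x • ker S m := hNxK (one_mem_ker hn)
  rw [← smul_ker_eq_of_one_mem hm hmg.2.1 hx0 h1xK]
  exact hNxK

end Structure

section Structure2

variable {S : Submodule F L}

/-- `0 • X = ⊥` for the pointwise action. [folklore] -/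
theorem zero_smul_submodule (X : Submodule F L) : (0 : L) • X = ⊥ := by
  rw [eq_bot_iff]
  intro y hy
  obtain ⟨z, -, rfl⟩ := mem_smul_iff.mp hy
  simp

variable (H : Hyp S) [FiniteDimensional F S]
include H

/-- **BSZ Proposition 21**: at a level `n ≤ dim S - 1` with `ker_n` below all lower kernels,
`ker_n` is multiplicatively closed (hence a field). The proof uses duality with respect to a
functional `σ` vanishing on `ker_n S` but not on `x ker_n S`.
[cite: BachocSerraZemor2018Kneser, Proposition 21] -/
theorem Hyp.ker_mul_ker_le {n : ℕ} (hn : n ∈ levels S)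
    (h20 : ∀ m ∈ levels S, m < n → ker S n ≤ ker S m) : ker S n * ker S n ≤ ker S n := by
  haveI := finiteDimensional_ker hn
  rw [Submodule.mul_le]
  intro x hx y hy
  by_cases hx0 : x = 0
  · rw [hx0, zero_mul]
    exact Submodule.zero_mem _
  suffices hsuff : x • (ker S n * S) ≤ ker S n * S by
    rw [← satur_ker hn, mem_satur]
    intro s hs
    rw [mul_assoc]
    exact hsuff (mul_mem_smul (Submodule.mul_mem_mul hy hs))
  by_contra hnot
  obtain ⟨v, hv, hvNS⟩ := SetLike.not_le_iff_exists.mp hnot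
  obtain ⟨σ, hσv, hσNS⟩ := Submodule.exists_le_ker_of_notMem hvNS
  have h1P : (1 : L) ∈ dmeet σ S (ker S n) (ker S n) := by
    refine ⟨one_mem_ker hn, fun u hu => ?_⟩
    rw [mul_one]
    exact hσNS hu
  have hxP : x ∉ perp σ (ker S n * S) := by
    intro hxp
    obtain ⟨u, hu, rfl⟩ := mem_smul_iff.mp hv
    apply hσv
    have := hxp u hu
    rwa [mul_comm] at this
  set P := dmeet σ S (ker S n) (ker S n) with hPdef
  have hMS := bdry_dmeet_add_bdry_dmeet_le σ H.one_mem (ker S n) (ker S n)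
  rw [bdry_ker hn, ← hPdef] at hMS
  have hPle : bdry S P ≤ n := by omega
  have hPsat : satur S P = P := satur_dmeet σ (satur_ker hn) _
  have hPN : P ≤ ker S n := dmeet_le σ S _ _
  have hPcell : P ∈ cells S :=
    mem_cells_of inferInstance hPsat h1P one_ne_zero fun h => ker_ne_top hn (eq_top_iff.mpr (h ▸ hPN))
  have hPn : bdry S P = n := by
    by_contra hne
    have hlt : bdry S P < n := lt_of_le_of_ne hPle hne
    have hm' := bdry_mem_levels hPcell
    haveI := finiteDimensional_ker hm'
    have h1 : finrank F (ker S (bdry S P)) ≤ finrank F P := finrank_ker_le hm' ⟨hPcell, rfl⟩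
    have h2 : finrank F (ker S n) ≤ finrank F (ker S (bdry S P)) :=
      Submodule.finrank_mono (h20 _ hm' hlt)
    have hPeq : P = ker S n := Submodule.eq_of_le_of_finrank_le hPN (h2.trans h1)
    have : bdry S P = n := by rw [hPeq, bdry_ker hn]
    exact hne this
  have hPeq : P = ker S n :=
    Submodule.eq_of_le_of_finrank_le hPN (finrank_ker_le hn ⟨hPcell, hPn⟩)
  have hxP' : x ∈ P := by
    rw [hPeq]
    exact hx
  exact hxP hxP'.2

/-- First step of **BSZ Proposition 22**: from a cell `X` of level `n` and `x ∈ X` with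
`x ker_n ⊄ X` one gets a lower level `k` such that `(X + x ker_n)^~ = (X + x ker_k)^~` is a cell
of level `k` and `X ∩ x ker_k` is again a cell of level `n` not containing `x ker_n` (so that
`k ∈ J`), together with the estimate `dim (X + x ker_n)S ≤ n + dim X + dim ker_n - 2`.
[cite: BachocSerraZemor2018Kneser, Proposition 22 (first part of the proof)] -/
theorem Hyp.prop22_step {n : ℕ} (hn : n ∈ levels S) (hns : n + 1 ≤ finrank F S)
    (IH : ∀ m ∈ levels S, m < n → m ∈ goodLevels S)
    (h20 : ∀ m ∈ levels S, m < n → ker S n ≤ ker S m)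
    {X : Submodule F L} (hX : X ∈ cellsAt S n) {x : L} (hxX : x ∈ X) (hx : ¬ x • ker S n ≤ X) :
    ∃ k ∈ levels S, k < n ∧ satur S (X ⊔ x • ker S n) ∈ cellsAt S k ∧
      satur S (X ⊔ x • ker S n) = satur S (X ⊔ x • ker S k) ∧
      (X ⊓ x • ker S k) ∈ cellsAt S n ∧ ¬ x • ker S n ≤ X ⊓ x • ker S k ∧
      finrank F ↥((X ⊔ x • ker S n) * S) + 2 ≤ n + finrank F X + finrank F (ker S n) := by
  haveI := finiteDimensional_ker hn
  haveI : FiniteDimensional F X := hX.1.1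
  have hx0 : x ≠ 0 := by
    rintro rfl
    exact hx (by rw [zero_smul_submodule]; exact bot_le)
  have hxN : x ∈ x • ker S n := self_mem_smul (one_mem_ker hn)
  have hZsat := satur_inf_of_eq hX.1.2.1 (satur_smul_of_eq hx0 (satur_ker hn))
  have hZcell : X ⊓ x • ker S n ∈ cells S :=
    mem_cells_of inferInstance hZsat ⟨hxX, hxN⟩ hx0 fun h =>
      hX.1.2.2.2 (eq_top_iff.mpr (h ▸ inf_le_left))
  have hZlt : finrank F ↥(X ⊓ x • ker S n) < finrank F (ker S n) := by
    rw [← finrank_smul hx0 (ker S n)]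
    apply Submodule.finrank_lt_finrank_of_lt
    exact lt_of_le_of_ne inf_le_right fun h => hx (h ▸ inf_le_left)
  have hZbig : n < bdry S (X ⊓ x • ker S n) := by
    by_contra hle
    push Not at hle
    have hlev := bdry_mem_levels hZcell
    rcases hle.lt_or_eq with hlt | heq
    · haveI := finiteDimensional_ker hlev
      have h1 := finrank_ker_le hlev ⟨hZcell, rfl⟩
      have h2 : finrank F (ker S n) ≤ finrank F (ker S (bdry S (X ⊓ x • ker S n))) :=
        Submodule.finrank_mono (h20 _ hlev hlt)
      omega
    · have h1 := finrank_ker_le hn ⟨hZcell, heq⟩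
      omega
  have hB4 := bdry_sup_add_bdry_inf_le H.one_mem X (x • ker S n)
  rw [hX.2, bdry_smul hx0, bdry_ker hn] at hB4
  have hdimU : finrank F ↥((X ⊔ x • ker S n) * S) + 2 ≤ n + finrank F X + finrank F (ker S n) := by
    have e1 := bdry_add_finrank H.one_mem (X ⊔ x • ker S n)
    have e2 := Submodule.finrank_sup_add_finrank_inf_eq X (x • ker S n)
    rw [finrank_smul hx0] at e2
    have e3 : 1 ≤ finrank F ↥(X ⊓ x • ker S n) :=
      Nat.pos_of_ne_zero fun h => hZcell.2.2.1 (Submodule.finrank_eq_zero.mp h)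
    omega
  have hUb : bdry S (satur S (X ⊔ x • ker S n)) + 1 ≤ n := by
    have := bdry_satur_le H.one_mem (X ⊔ x • ker S n)
    omega
  set U := satur S (X ⊔ x • ker S n) with hUdef
  haveI : FiniteDimensional F U := finiteDimensional_satur H.one_mem _
  have hxU : x ∈ U := le_satur S _ (Submodule.mem_sup_left hxX)
  have hUtop : U ≠ ⊤ := by
    intro hUt
    have hmul := mul_eq_top_of_satur_eq_top H.one_mem hUt
    refine sup_mul_ne_top (X := x • ker S n) (Y := X) ?_ (ne_bot_of_mem' ⟨hxN, hxX⟩ hx0) ?_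
      (by rwa [sup_comm])
    · rw [smul_mul, finrank_smul hx0, finrank_smul hx0, finrank_ker_mul H.one_mem hn]
      omega
    · intro hfdL
      haveI := hfdL
      obtain ⟨σ, hσ⟩ := exists_functional_ne_zero (F := F) (L := L)
      obtain ⟨hc, hb, hdim⟩ := perp_mul_mem_cells hσ H.one_mem hX.1
        (by rw [hX.2]; exact H.level_pos hn)
      have := finrank_ker_le hn ⟨hc, by rw [hb, hX.2]⟩
      rw [finrank_smul hx0]
      omega
  have hUcell : U ∈ cells S := mem_cells_of inferInstance (satur_satur S _) hxU hx0 hUtop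
  have hk := bdry_mem_levels hUcell
  have hkn : bdry S U < n := by omega
  have hkgood := IH _ hk hkn
  have hKU : ker S (bdry S U) * U ≤ U := hkgood.2.2 U ⟨hUcell, rfl⟩
  have hUeq : U = satur S (X ⊔ x • ker S (bdry S U)) := by
    refine le_antisymm ?_ ?_
    · exact satur_mono S (sup_le_sup_left (smul_mono (h20 _ hk hkn)) X)
    · have hle : X ⊔ x • ker S (bdry S U) ≤ U :=
        sup_le ((le_sup_left (b := x • ker S n)).trans (le_satur S _)) (smul_le_of_mul_le hKU hxU)
      calc satur S (X ⊔ x • ker S (bdry S U)) ≤ satur S U := satur_mono S hle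
        _ = U := by rw [hUdef, satur_satur]
  haveI := finiteDimensional_ker hk
  have hB4' := bdry_satur_sup_add_bdry_inf_le H.one_mem X (x • ker S (bdry S U))
  rw [hX.2, bdry_smul hx0, bdry_ker hk, ← hUeq] at hB4'
  have hVle : bdry S (X ⊓ x • ker S (bdry S U)) ≤ n := by omega
  have hVsat := satur_inf_of_eq hX.1.2.1 (satur_smul_of_eq hx0 (satur_ker hk))
  have hxV : x ∈ X ⊓ x • ker S (bdry S U) := ⟨hxX, self_mem_smul (one_mem_ker hk)⟩
  have hVcell : X ⊓ x • ker S (bdry S U) ∈ cells S :=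
    mem_cells_of inferInstance hVsat hxV hx0 fun h => hX.1.2.2.2 (eq_top_iff.mpr (h ▸ inf_le_left))
  have hVnot : ¬ x • ker S n ≤ X ⊓ x • ker S (bdry S U) := fun h => hx (h.trans inf_le_left)
  have hVn : bdry S (X ⊓ x • ker S (bdry S U)) = n := by
    by_contra hne
    have hlt := lt_of_le_of_ne hVle hne
    have hlev := bdry_mem_levels hVcell
    have hstab := (IH _ hlev hlt).2.2 _ ⟨hVcell, rfl⟩
    have hNV : ker S n * (X ⊓ x • ker S (bdry S U)) ≤ X ⊓ x • ker S (bdry S U) :=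
      (mul_le_mul_left (h20 _ hlev hlt) _).trans hstab
    exact hVnot (smul_le_of_mul_le hNV hxV)
  exact ⟨bdry S U, hk, hkn, ⟨hUcell, rfl⟩, hUeq, ⟨hVcell, hVn⟩, hVnot, hdimU⟩

/-- **BSZ Proposition 22**: at a level `n ≤ dim S - 1` with all lower levels good, `ker_n` below
all lower kernels and multiplicatively closed, every cell of level `n` is stabilised by `ker_n`.
[cite: BachocSerraZemor2018Kneser, Proposition 22] -/
theorem Hyp.ker_mul_le_of_mem_cellsAt {n : ℕ} (hn : n ∈ levels S) (hns : n + 1 ≤ finrank F S)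
    (IH : ∀ m ∈ levels S, m < n → m ∈ goodLevels S)
    (h20 : ∀ m ∈ levels S, m < n → ker S n ≤ ker S m) (h21 : ker S n * ker S n ≤ ker S n)
    {X : Submodule F L} (hX : X ∈ cellsAt S n) : ker S n * X ≤ X := by
  classical
  haveI := finiteDimensional_ker hn
  by_contra hXnot
  -- the set `J` of BSZ: levels `ν < n` carrying a bad cell of level `n` inside some `x ker_ν`
  let W : ℕ → Prop := fun ν => ν ∈ levels S ∧ ν < n ∧
    ∃ X' ∈ cellsAt S n, ∃ x' ∈ X', ¬ x' • ker S n ≤ X' ∧ X' ≤ x' • ker S ν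
  obtain ⟨x₀, hx₀X, hx₀⟩ : ∃ x ∈ X, ¬ x • ker S n ≤ X := by
    by_contra h
    push Not at h
    exact hXnot (mul_le_of_smul_le h)
  obtain ⟨k₀, hk₀, hk₀n, -, -, hV₀, hV₀not, -⟩ := H.prop22_step hn hns IH h20 hX hx₀X hx₀
  have hW₀ : W k₀ :=
    ⟨hk₀, hk₀n, _, hV₀, x₀, ⟨hx₀X, self_mem_smul (one_mem_ker hk₀)⟩, hV₀not, inf_le_right⟩
  -- `j = max J`
  have hWj : W (Nat.findGreatest W n) := Nat.findGreatest_spec hk₀n.le hW₀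
  have hjmax : ∀ ν, W ν → ν ≤ Nat.findGreatest W n := fun ν hν => Nat.le_findGreatest hν.2.1.le hν
  set j := Nat.findGreatest W n with hjdef
  obtain ⟨hj, hjn, X₁, hX₁, x, hxX₁, hxnot, hX₁le⟩ := hWj
  haveI : FiniteDimensional F X₁ := hX₁.1.1
  haveI := finiteDimensional_ker hj
  have hjgood := IH j hj hjn
  have hx0 : x ≠ 0 := by
    rintro rfl
    exact hxnot (by rw [zero_smul_submodule]; exact bot_le)
  -- first step again, for the extremal witness
  obtain ⟨k, hk, hkn, hUcell, -, hVcell, hVnot, hdimU⟩ := H.prop22_step hn hns IH h20 hX₁ hxX₁ hxnot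
  have hWk : W k := ⟨hk, hkn, _, hVcell, x, ⟨hxX₁, self_mem_smul (one_mem_ker hk)⟩, hVnot, inf_le_right⟩
  have hkj : k ≤ j := hjmax k hWk
  haveI := finiteDimensional_ker hk
  -- second step: `(X₁ + x ker_n)^~ = x ker_j` and `k = j`
  have hUle : satur S (X₁ ⊔ x • ker S n) ≤ x • ker S j := by
    rw [← satur_smul_of_eq hx0 (satur_ker hj)]
    exact satur_mono S (sup_le hX₁le (smul_mono (h20 j hj hjn)))
  have hfjk : finrank F (ker S j) ≤ finrank F (ker S k) := by
    rcases hkj.lt_or_eq with hlt | heq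
    · exact Submodule.finrank_mono (hjgood.1 k hk hlt)
    · rw [heq]
  have hUeq' : satur S (X₁ ⊔ x • ker S n) = x • ker S j := by
    refine Submodule.eq_of_le_of_finrank_le hUle ?_
    rw [finrank_smul hx0]
    exact hfjk.trans (finrank_ker_le hk hUcell)
  have hUS : (X₁ ⊔ x • ker S n) * S = x • (ker S j * S) := by
    rw [← satur_mul S (X₁ ⊔ x • ker S n), hUeq', smul_mul]
  have hdimj : finrank F ↥(ker S j * S) + 2 ≤ n + finrank F X₁ + finrank F (ker S n) := by
    rw [hUS, finrank_smul hx0] at hdimU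
    exact hdimU
  -- the next level `jp` above `j`
  have hex : ∃ ν, ν ∈ levels S ∧ j < ν := ⟨n, hn, hjn⟩
  obtain ⟨hjp, hjjp⟩ := Nat.find_spec hex
  have hjpmin : ∀ ν, ν ∈ levels S → j < ν → Nat.find hex ≤ ν :=
    fun ν hν hlt => Nat.find_min' hex ⟨hν, hlt⟩
  set jp := Nat.find hex with hjpdef
  have hjpn : jp ≤ n := hjpmin n hn hjn
  have hjp1 : jp + 1 ≤ finrank F S := by omega
  haveI := finiteDimensional_ker hjp
  -- third step: `dim ker_jp ≤ dim X₁`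
  have hdimX : finrank F (ker S jp) ≤ finrank F X₁ := by
    rcases hjpn.lt_or_eq with hlt | heq
    · have hjpgood := IH jp hjp hlt
      haveI := finiteDimensional_kerField hjp hjpgood.2.1
      haveI := finiteDimensional_kerField hn h21
      have hK'Kj : ker S jp ≤ ker S j := hjpgood.1 j hj hjjp
      have hlt1 : ker S jp * S < ker S j * S := by
        refine lt_of_le_of_ne (mul_le_mul_left hK'Kj S) fun h => ?_
        have hge : ker S j ≤ ker S jp := by
          rw [← satur_ker hjp]
          intro z hz
          rw [mem_satur_iff_smul_le, h]
          exact smul_le_mul hz S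
        have heq := le_antisymm hK'Kj hge
        have := bdry_ker hjp
        rw [heq, bdry_ker hj] at this
        omega
      have ha := finrank_add_finrank_le_of_stable_lt (kerField hjp hjpgood.2.1) (U := ker S jp * S)
        (V := ker S j * S)
        (fun k hk u hu => mul_mul_le hjpgood.2.1 S (Submodule.mul_mem_mul hk hu))
        (fun k hk u hu => mul_mul_le ((mul_le_mul_left hK'Kj _).trans hjgood.2.1) S
          (Submodule.mul_mem_mul hk hu)) hlt1
      rw [finrank_kerField] at ha
      have hNK' : ker S n ≤ ker S jp := h20 jp hjp hlt
      have hlt2 : ker S n * S < ker S jp * S := by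
        refine lt_of_le_of_ne (mul_le_mul_left hNK' S) fun h => ?_
        have hge : ker S jp ≤ ker S n := by
          rw [← satur_ker hn]
          intro z hz
          rw [mem_satur_iff_smul_le, h]
          exact smul_le_mul hz S
        have heq := le_antisymm hNK' hge
        have := bdry_ker hn
        rw [heq, bdry_ker hjp] at this
        omega
      have hb := finrank_add_finrank_le_of_stable_lt (kerField hn h21) (U := ker S n * S)
        (V := ker S jp * S)
        (fun k hk u hu => mul_mul_le h21 S (Submodule.mul_mem_mul hk hu))
        (fun k hk u hu => mul_mul_le ((mul_le_mul_left hNK' _).trans hjpgood.2.1) S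
          (Submodule.mul_mem_mul hk hu)) hlt2
      rw [finrank_kerField] at hb
      have e := finrank_ker_mul H.one_mem hn
      omega
    · rw [heq]
      exact finrank_ker_le hn hX₁
  -- fourth step: duality
  obtain ⟨σ, hσ⟩ := exists_functional_ne_zero (F := F) (L := L)
  obtain ⟨y, hy, hynot⟩ : ∃ y ∈ perp σ (X₁ * S), ¬ y • ker S n ≤ perp σ (X₁ * S) := by
    by_contra h
    push Not at h
    have hstab : ker S n * X₁ ≤ X₁ := by
      rw [Submodule.mul_le]
      intro k hk z hz
      refine stable_of_stable_perp hσ hX₁.1.2.1 (fun y hy => ?_) z hz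
      rw [mul_comm k y]
      exact h y hy (mul_mem_smul hk)
    exact hxnot (smul_le_of_mul_le hstab hxX₁)
  have hy0 : y ≠ 0 := by
    rintro rfl
    exact hynot (by rw [zero_smul_submodule]; exact bot_le)
  set R := dmeet σ S (y • ker S jp) X₁ with hRdef
  set Q := dmeet σ S X₁ (y • ker S jp) with hQdef
  have hMS := bdry_dmeet_add_bdry_dmeet_le σ H.one_mem (y • ker S jp) X₁
  rw [bdry_smul hy0, bdry_ker hjp, hX₁.2, ← hRdef, ← hQdef] at hMS
  have hyR : y ∈ R := ⟨self_mem_smul (one_mem_ker hjp), hy⟩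
  have hQne : Q ≠ ⊥ := by
    refine dmeet_ne_bot σ ?_ (ne_bot_of_mem' hyR hy0) ?_
    · rw [smul_mul, finrank_smul hy0, finrank_smul hy0, finrank_ker_mul H.one_mem hjp]
      omega
    · rw [finrank_smul hy0]
      exact hdimX
  have hQsat : satur S Q = Q := satur_dmeet σ hX₁.1.2.1 _
  have hQle : Q ≤ X₁ := dmeet_le σ S _ _
  obtain ⟨q, hq, hq0⟩ := (Submodule.ne_bot_iff _).mp hQne
  have hQcell : Q ∈ cells S :=
    mem_cells_of inferInstance hQsat hq hq0 fun h => hX₁.1.2.2.2 (eq_top_iff.mpr (h ▸ hQle))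
  have hX₁lt : X₁ < x • ker S j := by
    refine lt_of_le_of_ne hX₁le fun h => ?_
    have := hX₁.2
    rw [h, bdry_smul hx0, bdry_ker hj] at this
    omega
  have hQlt : finrank F Q < finrank F (ker S j) := by
    rw [← finrank_smul hx0 (ker S j)]
    exact (Submodule.finrank_mono hQle).trans_lt (Submodule.finrank_lt_finrank_of_lt hX₁lt)
  have hQlev := bdry_mem_levels hQcell
  have hQbig : j < bdry S Q := by
    by_contra hle
    push Not at hle
    have hfν : finrank F (ker S j) ≤ finrank F (ker S (bdry S Q)) := by
      rcases hle.lt_or_eq with hlt | heq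
      · haveI := finiteDimensional_ker hQlev
        exact Submodule.finrank_mono (hjgood.1 _ hQlev hlt)
      · rw [heq]
    have := finrank_ker_le hQlev ⟨hQcell, rfl⟩
    omega
  have hQjp : jp ≤ bdry S Q := hjpmin _ hQlev hQbig
  have hRle : bdry S R ≤ n := by omega
  have hRsat : satur S R = R := satur_dmeet σ (satur_smul_of_eq hy0 (satur_ker hjp)) _
  have hRyK : R ≤ y • ker S jp := dmeet_le σ S _ _
  have hRcell : R ∈ cells S :=
    mem_cells_of inferInstance hRsat hyR hy0 fun h =>
      (smul_mem_cells hy0 (ker_mem_cellsAt hjp).1).2.2.2 (eq_top_iff.mpr (h ▸ hRyK))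
  have hRperp : R ≤ perp σ (X₁ * S) := fun z hz => hz.2
  have hRnot : ¬ y • ker S n ≤ R := fun h => hynot (h.trans hRperp)
  have hRn : bdry S R = n := by
    by_contra hne
    have hlt := lt_of_le_of_ne hRle hne
    have hlev := bdry_mem_levels hRcell
    have hstab := (IH _ hlev hlt).2.2 _ ⟨hRcell, rfl⟩
    have hNR : ker S n * R ≤ R := (mul_le_mul_left (h20 _ hlev hlt) _).trans hstab
    exact hRnot (smul_le_of_mul_le hNR hyR)
  rcases hjpn.lt_or_eq with hlt | heq
  · have hWjp : W jp := ⟨hjp, hlt, R, ⟨hRcell, hRn⟩, y, hyR, hRnot, hRyK⟩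
    have := hjmax jp hWjp
    omega
  · rw [heq] at hRyK
    have hReq : R = y • ker S n := eq_smul_ker_of_le hn ⟨hRcell, hRn⟩ hy0 hRyK
    exact hRnot hReq.symm.le

/-- **BSZ Theorem 15**: every level `n ≤ dim S - 1` is good — the kernels are nested
(`ker_n ≤ ker_m` for `m < n`), are subfields, and `ker_n` stabilises every cell of level `n`.
[cite: BachocSerraZemor2018Kneser, Theorem 15] -/
theorem Hyp.mem_goodLevels : ∀ n ∈ levels S, n + 1 ≤ finrank F S → n ∈ goodLevels S := by
  intro n
  induction n using Nat.strong_induction_on with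
  | _ n IHn => ?_
  intro hn hns
  have IH : ∀ m ∈ levels S, m < n → m ∈ goodLevels S := fun m hm hmn => IHn m hmn hm (by omega)
  have h20 := H.ker_le_ker_of_lt hn hns IH
  have h21 := H.ker_mul_ker_le hn h20
  exact ⟨h20, h21, fun X hX => H.ker_mul_le_of_mem_cellsAt hn hns IH h20 h21 hX⟩

/-- **BSZ Theorem 3 in the case `L = F(S)`, `H(S) = F`** (§4, first paragraph): the kernel
`K` of the largest level `≤ dim S - 2` contains `1`, is not `F·1`, is a subfield, and
stabilises `TS` for EVERY finite-dimensional `T ≠ 0` with `dim TS ≤ dim T + dim S - 2`.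
[cite: BachocSerraZemor2018Kneser, Theorem 3 and Section 4] -/
theorem Hyp.exists_stabilizer : ∃ K : Submodule F L, (1 : L) ∈ K ∧ K ≠ Submodule.span F {(1 : L)} ∧
    K * K ≤ K ∧ FiniteDimensional F K ∧
    ∀ T : Submodule F L, FiniteDimensional F T → T ≠ ⊥ →
      finrank F ↥(T * S) + 2 ≤ finrank F T + finrank F S → K * (T * S) ≤ T * S := by
  obtain ⟨m₀, hm₀, hm₀s⟩ := H.exists_level_add_two_le
  obtain ⟨mx, hmx, hmxs, hmxmax⟩ := exists_max_level_lt hm₀ (show m₀ < finrank F S - 1 by omega)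
  have hmxgood := H.mem_goodLevels mx hmx (by omega)
  haveI := finiteDimensional_ker hmx
  refine ⟨ker S mx, one_mem_ker hmx, fun h => ?_, hmxgood.2.1, inferInstance, ?_⟩
  · have := bdry_ker hmx
    rw [h, H.span_one_mem_cellsAt.2] at this
    omega
  · intro T hT hTb hsmall
    haveI := hT
    by_cases hTS : T * S = ⊤
    · rw [hTS]
      exact le_top
    haveI := finiteDimensional_satur H.one_mem T
    obtain ⟨t, ht, ht0⟩ := (Submodule.ne_bot_iff T).mp hTb
    have hcell : satur S T ∈ cells S :=
      mem_cells_of inferInstance (satur_satur S T) (le_satur S T ht) ht0 fun htop =>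
        hTS (mul_eq_top_of_satur_eq_top H.one_mem htop)
    have hk := bdry_mem_levels hcell
    have hks : bdry S (satur S T) + 2 ≤ finrank F S := by
      have h1 := bdry_satur_le H.one_mem T
      have h2 := bdry_add_finrank H.one_mem T
      omega
    have hkgood := H.mem_goodLevels _ hk (by omega)
    have hstab : ker S (bdry S (satur S T)) * satur S T ≤ satur S T := hkgood.2.2 _ ⟨hcell, rfl⟩
    have hle : ker S mx ≤ ker S (bdry S (satur S T)) := by
      rcases (hmxmax _ hk (by omega)).lt_or_eq with hlt | heq
      · exact hmxgood.1 _ hk hlt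
      · rw [heq]
    rw [← satur_mul S T]
    exact mul_mul_le ((mul_le_mul_left hle _).trans hstab) S

end Structure2

end Literature.Combinatorics.Additive.LinKneser
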